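import Summits.ValiantsHypothesis.ValiantsHypothesis.Theorems.NewtonUnitEquationsTwoProductsRankOneFourLawPlanar
import HarnessLib

/-!
# Route NewtonUnitEquations — crux `TwoProducts` (stmt-ValiantsHypothesis-5906), line `relation_ladder`, rung R6 (four-term
# rank one): the SEGRE LIFT — the PROVED SPLIT `BinExpPencilCount → RankOneFourLaw` — part 5/6 — the planar instance: the upstairs weights (Part T6, second half) and the slicing per visible point (Part T7, start)

(T6, continued) the upstairs weights: `rW`, the pencil parameter `RelData.tPar`, the weight `RelData.theta` with its coordinate values
(`theta_a/b/c/d/other`), the relation `rW_rel`, strict positivity `theta_pos` for valid `ξ`, linear weights of single exponents and toric images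
(`lwt_single`, `lwt_piT`), `θ(segM i) = -wt ξ (enum i)` (`lwt_theta_segM`, `lwt_theta_piT`), the letter swap `swLetter` and the slice identity
`lwt_theta_balanced`; (T7) per visible point: a visible point `l` (valid `ξ`) yields a balanced toric point `x₀` over it with bad coordinate
`b = x₀(W₁) ≤ m`, whose reduced exponent `x̂₀` is a zero-avoiding STRICT minimiser of the slice functional `ν ↦ Σ_i (-wt ξ (swLetter i)) ν_i` on
`{ν : F_b(ν) ≠ 0}` over ALL of `ℕ^s` (competitors of degree `> R` handled by `deg ≤ lwt`) — `RelData.sliceMin_of_visible`.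

PORT NOTE (val-lit-p11 g1, literature-prover seat, helper mode `--supports stmt-ValiantsHypothesis-5906 --as helper`, no stub credit
claimed): part 5/6 of a VERBATIM Theorems-side port of val-idea-8 g3's sorry-free module
`Cruxes/TwoProducts/Lines/relation_ladder_R6.lean` (tree @1dcc86cce347; file sha256 36828fc46563…; 1 653 lines; `lean check` rc 0, 0 sorries)
into files of ≤ 400 lines, as tasked by the val-lit desk (RULING #273 (b)). ALL mathematics and ALL proofs below are val-idea-8 g3's (engine
memo `Cruxes/TwoProducts/Lines/relation_ladder_R6_engine.md` rev 3); the port changes only: the file split, the import chain, two deprecated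
Mathlib names (`Finsupp.coe_finset_sum` → `Finsupp.coe_finsetSum`, `Finsupp.finset_sum_apply` → `Finsupp.finsetSum_apply`), `omit […] in`
annotations and one-line docstrings on 45 API lemmas required by the tree's zero-warning / docstring lint. Namespace = the author's
(`…Theorems.NewtonUnitEquations.TwoProducts.PermutationType`, as in the R3♯ port `…PermutationType{WeightOrder,Lifted,PushForward,Count,Family}`).
Nothing here closes the line's residual, the crux `TwoProducts` (5906) or `VP ≠ VNP`; no summit statement is proved.

Cut table: in the module docstring of part 1/6 (`…RankOneFourLawToric`); this file = source l. 1147–1288, 1291–1412.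

Honest scope (the author's): shapes `α = β + γ` (R6b), `2β = α + γ` (R6c) and coincidence rank `≥ 2` (R7) are NOT covered and go to the
residual of skeleton v14. Nothing here moves VP ≠ VNP; `TwoProducts` (5906) stays OPEN. [folklore]
-/

noncomputable section

-- Sub = Summit single-conjunct layout: the duplicated namespace component is mandated by the tree.
set_option linter.dupNamespace false
set_option linter.unusedSimpArgs false

namespace Summit.ValiantsHypothesis.ValiantsHypothesis.Theorems.NewtonUnitEquations.TwoProducts.PermutationType
open scoped BigOperators
open MvPolynomial

variable {σ : Type*} [Fintype σ] [DecidableEq σ]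

variable (I : FourIdx σ)

section SegrePlanar
open Summit.ValiantsHypothesis.ValiantsHypothesis.Theorems.NewtonUnitEquations.TwoProducts.FormalLogLinearisation
open Summit.ValiantsHypothesis.ValiantsHypothesis.Theorems.NewtonUnitEquations.TwoProducts.PlanarCell

variable {m : ℕ} {u v : Fin m → MvPolynomial (Fin 2) ℂ} (D : RelData u v)

/-! ### The upstairs weights -/

/-- Letter weights `r_i = -wt ξ (enum i) > 0`. [folklore] -/
def rW (ξ : Fin 2 → ℝ) (i : Fin (sE u v)) : ℝ := -wt ξ (enum u v i)

/-- The free parameter `t = z₁` of the Riesz weight refinement: midpoint of `(max(0, Γ - B), min(A, Γ))`. [folklore] -/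
def RelData.tPar (ξ : Fin 2 → ℝ) : ℝ :=
  (max 0 (rW (u := u) (v := v) ξ D.idx.c - rW ξ D.idx.b) + min (rW ξ D.idx.a) (rW ξ D.idx.c)) / 2

/-- **The upstairs weights** `θ`: `z₁ = t`, `z₂ = B - Γ + t`, `w₁ = A - t`, `w₂ = Γ - t`, `r_i` elsewhere. [folklore] -/
def RelData.theta (ξ : Fin 2 → ℝ) (i : Fin (sE u v)) : ℝ :=
  if i = D.idx.a then D.tPar ξ else if i = D.idx.b then rW ξ D.idx.b - rW ξ D.idx.c + D.tPar ξ
  else if i = D.idx.c then rW ξ D.idx.a - D.tPar ξ else if i = D.idx.d then rW ξ D.idx.c - D.tPar ξ else rW ξ i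

omit [Fintype σ] [DecidableEq σ] in
/-- The upstairs weight at `a`: `z₁ = t`. [folklore] -/
theorem RelData.theta_a (ξ : Fin 2 → ℝ) : D.theta ξ D.idx.a = D.tPar ξ := by
  unfold RelData.theta; rw [if_pos rfl]
omit [Fintype σ] [DecidableEq σ] in
/-- The upstairs weight at `b`: `z₂ = B - Γ + t`. [folklore] -/
theorem RelData.theta_b (ξ : Fin 2 → ℝ) : D.theta ξ D.idx.b = rW ξ D.idx.b - rW ξ D.idx.c + D.tPar ξ := by
  unfold RelData.theta; rw [if_neg D.idx.hab.symm, if_pos rfl]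
omit [Fintype σ] [DecidableEq σ] in
/-- The upstairs weight at `c`: `w₁ = A - t`. [folklore] -/
theorem RelData.theta_c (ξ : Fin 2 → ℝ) : D.theta ξ D.idx.c = rW ξ D.idx.a - D.tPar ξ := by
  unfold RelData.theta; rw [if_neg D.idx.hac.symm, if_neg D.idx.hbc.symm, if_pos rfl]
omit [Fintype σ] [DecidableEq σ] in
/-- The upstairs weight at `d`: `w₂ = Γ - t`. [folklore] -/
theorem RelData.theta_d (ξ : Fin 2 → ℝ) : D.theta ξ D.idx.d = rW ξ D.idx.c - D.tPar ξ := by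
  unfold RelData.theta; rw [if_neg D.idx.had.symm, if_neg D.idx.hbd.symm, if_neg D.idx.hcd.symm, if_pos rfl]
omit [Fintype σ] [DecidableEq σ] in
/-- The upstairs weight is the letter weight `r_i` away from the four relation indices. [folklore] -/
theorem RelData.theta_other (ξ : Fin 2 → ℝ) (i : Fin (sE u v)) (ha : i ≠ D.idx.a) (hb : i ≠ D.idx.b) (hc : i ≠ D.idx.c)
    (hd : i ≠ D.idx.d) : D.theta ξ i = rW ξ i := by
  unfold RelData.theta; rw [if_neg ha, if_neg hb, if_neg hc, if_neg hd]

omit [Fintype σ] [DecidableEq σ] in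
/-- The relation on weights: `A + B = Γ + Δ`. [folklore] -/
theorem RelData.rW_rel (ξ : Fin 2 → ℝ) : rW ξ D.idx.a + rW ξ D.idx.b = rW ξ D.idx.c + rW ξ D.idx.d := by
  unfold rW
  rw [D.enum_a, D.enum_b, D.enum_c, D.enum_d, ← neg_add, ← neg_add, ← wt_add, ← wt_add, D.hrel]

omit [Fintype σ] [DecidableEq σ] in
/-- The upstairs weights are strictly positive for a valid `ξ`. [folklore] -/
theorem RelData.theta_pos (ξ : Fin 2 → ℝ) (hval : ValidWeight u v ξ) (i : Fin (sE u v)) : 0 < D.theta ξ i := by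
  have hr : ∀ j, 0 < rW (u := u) (v := v) ξ j := fun j => by
    unfold rW; linarith [wt_enum_neg u v ξ hval j]
  have hA := hr D.idx.a; have hB := hr D.idx.b; have hC := hr D.idx.c; have hD := hr D.idx.d
  have hrel := D.rW_rel ξ
  have hlo : max 0 (rW (u := u) (v := v) ξ D.idx.c - rW ξ D.idx.b) < min (rW (u := u) (v := v) ξ D.idx.a) (rW ξ D.idx.c) := by
    rw [max_lt_iff, lt_min_iff, lt_min_iff]
    exact ⟨⟨hA, hC⟩, by linarith, by linarith⟩
  have ht1 : max 0 (rW (u := u) (v := v) ξ D.idx.c - rW ξ D.idx.b) < D.tPar ξ := by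
    unfold RelData.tPar; linarith
  have ht2 : D.tPar ξ < min (rW (u := u) (v := v) ξ D.idx.a) (rW ξ D.idx.c) := by
    unfold RelData.tPar; linarith
  rw [max_lt_iff] at ht1
  rw [lt_min_iff] at ht2
  unfold RelData.theta
  split_ifs
  · exact ht1.1
  · linarith [ht1.2]
  · linarith [ht2.1]
  · linarith [ht2.2]
  · exact hr i

omit [DecidableEq σ] in
/-- Linear weights of a single letter. [folklore] -/
theorem lwt_single (θ : σ → ℝ) (i : σ) : lwt θ (Finsupp.single i 1) = θ i := by
  classical
  unfold lwt
  simp [Finsupp.single_apply]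

omit [DecidableEq σ] in
/-- Linear weights commute with monomial substitutions. [folklore] -/
theorem lwt_piT {τ : Type*} [Fintype τ] (θ : τ → ℝ) (M : σ → (τ →₀ ℕ)) (L : σ →₀ ℕ) :
    lwt θ (piT M L) = lwt (fun i => lwt θ (M i)) L := by
  unfold lwt
  simp only [piT_apply]
  push_cast
  simp only [Finset.mul_sum, Finset.sum_mul]
  rw [Finset.sum_comm]
  refine Finset.sum_congr rfl fun i _ => Finset.sum_congr rfl fun j _ => by ring

omit [Fintype σ] [DecidableEq σ] in
/-- The upstairs weight of a substituted letter is its planar weight. [folklore] -/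
theorem RelData.lwt_theta_segM (ξ : Fin 2 → ℝ) (i : Fin (sE u v)) : lwt (D.theta ξ) (segM D.idx i) = rW ξ i := by
  have hrel := D.rW_rel ξ
  by_cases hia : i = D.idx.a
  · subst hia; rw [segM_a, lwt_add, lwt_single, lwt_single, D.theta_a, D.theta_c]; ring
  by_cases hib : i = D.idx.b
  · subst hib; rw [segM_b, lwt_add, lwt_single, lwt_single, D.theta_b, D.theta_d]; ring
  by_cases hic : i = D.idx.c
  · subst hic; rw [segM_c, lwt_add, lwt_single, lwt_single, D.theta_a, D.theta_d]; ring
  by_cases hid : i = D.idx.d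
  · subst hid; rw [segM_d, lwt_add, lwt_single, lwt_single, D.theta_b, D.theta_c]; linarith
  rw [segM_other D.idx i hia hib hic hid, lwt_single, D.theta_other ξ i hia hib hic hid]

omit [Fintype σ] [DecidableEq σ] in
/-- On toric images the upstairs weight is the planar weight of the push-forward. [folklore] -/
theorem RelData.lwt_theta_piT (ξ : Fin 2 → ℝ) (L : Fin (sE u v) →₀ ℕ) :
    lwt (D.theta ξ) (piT (segM D.idx) L) = -wt ξ (piE D.E' (piT (segM D.idx) L)) := by
  rw [lwt_piT, D.piE_E'_piT, ← lwt_eq_neg_wt]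
  congr 1
  funext i
  exact D.lwt_theta_segM ξ i

/-- The slice weights: `Γ` on `Z₁`, `B` on `Z₂`, `0` on `W₁, W₂`, `r_i` elsewhere — as the letters they are weights of. [folklore] -/
def RelData.swLetter (i : Fin (sE u v)) : Expo :=
  if i = D.idx.a then D.γ else if i = D.idx.c ∨ i = D.idx.d then 0 else enum u v i

omit [Fintype σ] [DecidableEq σ] in
/-- **The slice identity for upstairs weights.** For balanced `x`:
`θ(x) = Σ_i (-wt ξ (swLetter i)) · x̂_i + (A - Γ) · x_c`. [folklore] -/
theorem RelData.lwt_theta_balanced (ξ : Fin 2 → ℝ) (x : Fin (sE u v) →₀ ℕ) (hx : Balanced D.idx x) :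
    lwt (D.theta ξ) x = (∑ i, -wt ξ (D.swLetter i) * ((xhat D.idx x i : ℕ) : ℝ)) +
      (rW ξ D.idx.a - rW ξ D.idx.c) * ((x D.idx.c : ℕ) : ℝ) := by
  have F := And.intro D.idx.hab (And.intro D.idx.hac (And.intro D.idx.had (And.intro D.idx.hbc (And.intro D.idx.hbd D.idx.hcd))))
  unfold Balanced at hx
  have hxR : ((x D.idx.d : ℕ) : ℝ) = (x D.idx.a : ℝ) + (x D.idx.b : ℝ) - (x D.idx.c : ℝ) := by
    have : ((x D.idx.a + x D.idx.b : ℕ) : ℝ) = ((x D.idx.c + x D.idx.d : ℕ) : ℝ) := by rw [hx]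
    push_cast at this; linarith
  unfold lwt
  rw [sum_four_split D.idx, sum_four_split D.idx, xhat_a, xhat_b, xhat_c, xhat_d]
  have hrest : ∑ j ∈ rest D.idx, D.theta ξ j * ((x j : ℕ) : ℝ) =
      ∑ j ∈ rest D.idx, -wt ξ (D.swLetter j) * ((xhat D.idx x j : ℕ) : ℝ) := by
    refine Finset.sum_congr rfl fun j hj => ?_
    rw [mem_rest] at hj
    rw [xhat_other D.idx x j hj.2.2.1 hj.2.2.2]
    unfold RelData.theta RelData.swLetter rW
    rw [if_neg hj.1, if_neg hj.2.1, if_neg hj.2.2.1, if_neg hj.2.2.2, if_neg hj.1, if_neg (not_or.mpr ⟨hj.2.2.1, hj.2.2.2⟩)]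
  rw [hrest]
  have hsa : D.swLetter D.idx.a = D.γ := by unfold RelData.swLetter; rw [if_pos rfl]
  have hsb : D.swLetter D.idx.b = enum u v D.idx.b := by
    unfold RelData.swLetter; rw [if_neg F.1.symm, if_neg (not_or.mpr ⟨F.2.2.2.1, F.2.2.2.2.1⟩)]
  have hsc : D.swLetter D.idx.c = 0 := by
    unfold RelData.swLetter; rw [if_neg F.2.1.symm, if_pos (Or.inl rfl)]
  have hsd : D.swLetter D.idx.d = 0 := by
    unfold RelData.swLetter; rw [if_neg F.2.2.1.symm, if_pos (Or.inr rfl)]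
  rw [hsa, hsb, hsc, hsd, FormalLogLinearisation.wt_zero]
  rw [D.theta_a, D.theta_b, D.theta_c, D.theta_d, hxR]
  have hγ : -wt ξ D.γ = rW ξ D.idx.c := by unfold rW; rw [D.enum_c]
  have hβ : -wt ξ (enum u v D.idx.b) = rW ξ D.idx.b := rfl
  rw [hγ, hβ]
  push_cast
  ring

end SegrePlanar

/-! ## Part T7: the slicing — per visible point; the count; the arithmetic; the law -/

section SegreCount
open Summit.ValiantsHypothesis.ValiantsHypothesis.Theorems.NewtonUnitEquations.TwoProducts.FormalLogLinearisation
open Summit.ValiantsHypothesis.ValiantsHypothesis.Theorems.NewtonUnitEquations.TwoProducts.PlanarCell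

variable {m : ℕ} {u v : Fin m → MvPolynomial (Fin 2) ℂ} (D : RelData u v)

omit [Fintype σ] [DecidableEq σ] in
/-- **Per visible point.** A visible point `l` (valid `ξ`) yields a balanced toric point `x₀` over it with bad coordinate
`b = x₀(W₁) ≤ m`, whose reduced exponent `x̂₀` is a zero-avoiding STRICT minimiser of the slice functional
`ν ↦ Σ_i (-wt ξ (swLetter i)) ν_i` on `{ν : F_b(ν) ≠ 0}` over ALL of `ℕ^s`. [folklore] -/
theorem RelData.sliceMin_of_visible (hu : ∀ j, coeff 0 (u j) = 0) (hv : ∀ j, coeff 0 (v j) = 0)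
    (hinj : Set.InjOn (piE D.E') ↑D.GT.support) (ξ : Fin 2 → ℝ) (hval : ValidWeight u v ξ) (l : Expo)
    (htop : IsStrictTop ξ ↑(tailDiff u v).support l) :
    ∃ x₀ : Fin (sE u v) →₀ ℕ, piE D.E' x₀ = l ∧ Balanced D.idx x₀ ∧ x₀ D.idx.c ≤ m ∧
      Fsl D.idx (cU u v) (cV u v) (x₀ D.idx.c) (xhat D.idx x₀) ≠ 0 ∧
      ∀ ν : Fin (sE u v) → ℕ, ν ≠ ⇑(xhat D.idx x₀) → Fsl D.idx (cU u v) (cV u v) (x₀ D.idx.c) ν ≠ 0 →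
        ∑ i, -wt ξ (D.swLetter i) * ((xhat D.idx x₀ i : ℕ) : ℝ) < ∑ i, -wt ξ (D.swLetter i) * (ν i : ℝ) := by
  classical
  have _hu := hu; have _hv := hv
  obtain ⟨x₀, hx₀, hπ, hmin⟩ := D.lifted_of_visible hinj ξ l htop
  obtain ⟨L₀, hL₀, hx₀L⟩ := D.exists_of_mem_support_GT x₀ hx₀
  have hbal : Balanced D.idx x₀ := hx₀L ▸ balanced_piT D.idx L₀
  have hdegL : deg L₀ ≤ m := deg_le_of_mem_support_liftG _ _ L₀ hL₀
  have hc_le : x₀ D.idx.c ≤ m := by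
    rw [← hx₀L, piT_segM_c]
    have h := deg_eq_sum L₀
    rw [sum_four_split D.idx] at h
    omega
  -- the upstairs weights and their normalisation
  set θ : Fin (sE u v) → ℝ := D.theta ξ with hθdef
  have hθpos : ∀ i, 0 < θ i := D.theta_pos ξ hval
  have hne : (Finset.univ : Finset (Fin (sE u v))).Nonempty := ⟨D.idx.a, Finset.mem_univ _⟩
  set θmin : ℝ := Finset.univ.inf' hne θ with hθmin
  have hθmin_pos : 0 < θmin := by
    obtain ⟨i, -, hi⟩ := Finset.exists_mem_eq_inf' hne θ
    rw [hθmin, hi]; exact hθpos i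
  have hθmin_le : ∀ i, θmin ≤ θ i := fun i => Finset.inf'_le θ (Finset.mem_univ i)
  set θ' : Fin (sE u v) → ℝ := fun i => θ i / θmin with hθ'
  have hθ'1 : ∀ i, 1 ≤ θ' i := fun i => by
    rw [hθ']; simp only; rw [le_div_iff₀ hθmin_pos, one_mul]; exact hθmin_le i
  have hlwt' : ∀ x : Fin (sE u v) →₀ ℕ, lwt θ' x = lwt θ x / θmin := fun x => by
    unfold lwt; rw [Finset.sum_div]
    refine Finset.sum_congr rfl fun i _ => ?_
    rw [hθ']; ring
  have hlwtG : ∀ x ∈ D.GT.support, lwt θ x = -wt ξ (piE D.E' x) := fun x hx => by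
    obtain ⟨L, -, rfl⟩ := D.exists_of_mem_support_GT x hx
    exact D.lwt_theta_piT ξ L
  have hminθ' : x₀ ∈ (phiT (segM D.idx) (liftG (cU u v) (cV u v))).support ∧
      ∀ x ∈ (phiT (segM D.idx) (liftG (cU u v) (cV u v))).support, x ≠ x₀ → lwt θ' x₀ < lwt θ' x := by
    refine ⟨hx₀, fun x hx hne' => ?_⟩
    rw [hlwt', hlwt']
    apply div_lt_div_of_pos_right _ hθmin_pos
    rw [hlwtG x₀ hx₀, hlwtG x hx, hπ]
    linarith [hmin x hx hne']
  have hA := toric_minLog (segM D.idx) (segM_ne_zero D.idx) θ' hθ'1 (cU u v) (cV u v) x₀ hminθ'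
  set R : ℕ := ⌊lwt θ' x₀⌋₊ + 1 with hRdef
  have hRlt : lwt θ' x₀ < R := by rw [hRdef]; push_cast; exact Nat.lt_floor_add_one _
  -- degrees of `x₀`
  have hx₀ne : x₀ ≠ 0 := by
    intro h0
    have := mem_support_iff.mp hx₀
    apply this
    rw [h0]
    unfold RelData.GT
    rw [phiT_liftG, coeff_sub,
      coeff_zero_prod_eq_one _ (fun j => coeff_zero_one_add_phiT_lin (segM D.idx) (segM_ne_zero D.idx) _),
      coeff_zero_prod_eq_one _ (fun j => coeff_zero_one_add_phiT_lin (segM D.idx) (segM_ne_zero D.idx) _), sub_self]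
  have hdeg1 : 1 ≤ deg (xhat D.idx x₀) := by
    by_contra h0
    push Not at h0
    apply hx₀ne
    apply (deg_eq_zero_iff x₀).mp
    have h1 := deg_eq_deg_xhat_add D.idx x₀
    have h2 := deg_xhat D.idx x₀
    unfold Balanced at hbal
    omega
  have hdegR : deg (xhat D.idx x₀) ≤ R := by
    have h1 := deg_eq_deg_xhat_add D.idx x₀
    have h2 : (deg x₀ : ℝ) ≤ lwt θ' x₀ := deg_le_lwt θ' hθ'1 x₀
    have h3 : (deg x₀ : ℝ) < R := lt_of_le_of_lt h2 hRlt
    have h4 : deg x₀ < R := by exact_mod_cast h3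
    omega
  have hF0 : Fsl D.idx (cU u v) (cV u v) (x₀ D.idx.c) (xhat D.idx x₀) ≠ 0 :=
    (mem_support_segre_logTrunc_iff D.idx (cU u v) (cV u v) R x₀ hbal hdeg1 hdegR).mp hA.1
  refine ⟨x₀, hπ, hbal, hc_le, hF0, fun ν hν hFν => ?_⟩
  obtain ⟨hνc, hνd, hbν⟩ := shape_of_Fsl_ne_zero D.idx (cU u v) (cV u v) _ ν hFν
  set x' : Fin (sE u v) →₀ ℕ := xOf D.idx (x₀ D.idx.c) ν with hx'def
  have hbal' : Balanced D.idx x' := xOf_balanced D.idx _ ν hbν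
  have hxh' : ⇑(xhat D.idx x') = ν := xhat_xOf D.idx _ ν hνc hνd
  have hx'c : x' D.idx.c = x₀ D.idx.c := xOf_c D.idx _ ν
  have hne' : x' ≠ x₀ := by
    intro h; apply hν; rw [← hxh', h]
  have hdeg1' : 1 ≤ deg (xhat D.idx x') := by
    by_contra h0
    push Not at h0
    have hz : xhat D.idx x' = 0 := (deg_eq_zero_iff _).mp (by omega)
    have hνz : ∀ j, ν j = 0 := fun j => by rw [← hxh', hz]; rfl
    have hb0 : x₀ D.idx.c = 0 := by have := hνz D.idx.a; have := hνz D.idx.b; omega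
    apply hFν
    rw [hb0]; exact Fsl_zero_zero D.idx (cU u v) (cV u v) ν hνz
  have hlt' : lwt θ' x₀ < lwt θ' x' := by
    by_cases hR' : deg (xhat D.idx x') ≤ R
    · have hmem : x' ∈ (phiT (segM D.idx) (logTrunc (cU u v) (cV u v) R)).support :=
        (mem_support_segre_logTrunc_iff D.idx (cU u v) (cV u v) R x' hbal' hdeg1' hR').mpr
          (by rw [hx'c, hxh']; exact hFν)
      exact hA.2 x' hmem hne'
    · push Not at hR'
      have h1 := deg_eq_deg_xhat_add D.idx x'
      have h2 : (deg x' : ℝ) ≤ lwt θ' x' := deg_le_lwt θ' hθ'1 x'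
      have h3 : (R : ℝ) < deg (xhat D.idx x') := by exact_mod_cast hR'
      have h4 : (deg (xhat D.idx x') : ℝ) ≤ deg x' := by exact_mod_cast (by omega : deg (xhat D.idx x') ≤ deg x')
      linarith
  have hlt : lwt θ x₀ < lwt θ x' := by
    have := hlt'
    rw [hlwt', hlwt'] at this
    exact (div_lt_div_iff_of_pos_right hθmin_pos).mp this
  rw [hθdef, D.lwt_theta_balanced ξ x₀ hbal, D.lwt_theta_balanced ξ x' hbal', hx'c] at hlt
  rw [hxh'] at hlt
  linarith

end SegreCount

end Summit.ValiantsHypothesis.ValiantsHypothesis.Theorems.NewtonUnitEquations.TwoProducts.PermutationType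

end
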